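import Mathlib.AlgebraicGeometry.Morphisms.FormallyUnramified
import Mathlib.AlgebraicGeometry.Morphisms.Preimmersion
import Mathlib.AlgebraicGeometry.Morphisms.Flat
import Mathlib.RingTheory.Unramified.LocalRing
import Mathlib.RingTheory.Flat.FaithfullyFlat.Algebra
import HarnessLib

/-!
# Crux `NoZenoR` (stmt-ResolutionOfSingularities-19943), β layer, `stub_L1wCoreF` descent brick for BC-4b hypothesis (U):
# UNRAMIFIED POINTS — `𝔪_{f x}·𝒪_{X,x} = 𝔪_x` along formally unramified morphisms and along flat preimmersions

Route `ResolutionOfSingularities/HomologicalConductor`, crux chain W4.4.  OURS (cell res-hironaka, seat res-L0-w44-stub-2,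
(L1)-PREP v4 §2 / planner (ρ48)); AI-written, weaker than expert review; nothing here is a statement of the manuscript under
review (Hironaka 2017).  Def-free, fact-free, `--supports 19943 --as helper`.

The hypothesis `hunr` of `…NoZenoGaloisAscent.isMinimalResolution_of_flat_of_symmetric` asks that the base change
`σ : X_B → X` satisfy `𝔪_{σ ζ}·𝒪_{X_B,ζ} = 𝔪_ζ` at the points over the exceptional curves.  For res-D-pv-039's D2″ hop
`S → S' = integralClosure S L` (finite ÉTALE) `→ Ŝ = (S')_𝔫` (a localisation), `σ` factors as a base change `σ₂` of the
localisation (a flat preimmersion: isomorphisms on local rings) followed by a base change `σ₁` of the finite étale map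
(formally unramified and locally of finite type).  Generic lemmas:

* **`map_maximalIdeal_stalkMap_eq_of_formallyUnramified`** — for `f` formally unramified and locally of finite type,
  `𝔪_{f x}·𝒪_{X,x} = 𝔪_x` at every point (Mathlib `Algebra.FormallyUnramified.map_maximalIdeal`, Stacks 00UW, for the
  essentially-of-finite-type formally unramified stalk map);
* `isIso_stalkMap_of_isPreimmersion_of_flat` — a FLAT preimmersion (e.g. a base change of `Spec S'_𝔫 → Spec S'`,
  Mathlib `IsPreimmersion.of_isLocalization`) induces isomorphisms on local rings (surjective on stalks; a flat local
  homomorphism is faithfully flat, hence injective);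
* `map_maximalIdeal_eq_of_bijective` — a bijective local homomorphism carries `𝔪` onto `𝔪`;
* **`map_maximalIdeal_stalkMap_comp_eq`** — if `f₁` is unramified at `g x` in the above sense and `g` induces an
  isomorphism of local rings at `x`, then `g ≫ f₁` is unramified at `x`.

References: The Stacks Project, Tag 00UW (unramified local homomorphisms), Tag 02FM [`StacksProject`]; context
J. Lipman, Publ. Math. IHÉS 36 (1969) §16 (16.1) p. 231 [`Lipman1969`].
-/

noncomputable section

-- single-problem summit: the doubled namespace component `ResolutionOfSingularities` is forced
set_option linter.dupNamespace false

namespace Summit.ResolutionOfSingularities.ResolutionOfSingularities.Theorems.NoZeno.ExcCount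

open CategoryTheory AlgebraicGeometry IsLocalRing

universe u

/-- **Formally unramified morphisms locally of finite type are unramified at every point**: `𝔪_{f x}·𝒪_{X,x} = 𝔪_x`
(the stalk map is a formally unramified, essentially-of-finite-type local homomorphism). [cite: StacksProject, Tag 00UW] -/
theorem map_maximalIdeal_stalkMap_eq_of_formallyUnramified {X Y : Scheme.{u}} (f : X ⟶ Y) [FormallyUnramified f]
    [LocallyOfFiniteType f] (x : X) :
    (maximalIdeal (Y.presheaf.stalk (f.base x))).map (f.stalkMap x).hom = maximalIdeal (X.presheaf.stalk x) := by
  algebraize [(f.stalkMap x).hom]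
  haveI : IsLocalHom (algebraMap (Y.presheaf.stalk (f.base x)) (X.presheaf.stalk x)) :=
    inferInstanceAs <| IsLocalHom (f.stalkMap x).hom
  haveI : Algebra.EssFiniteType (Y.presheaf.stalk (f.base x)) (X.presheaf.stalk x) := by
    rw [← RingHom.essFiniteType_algebraMap, RingHom.algebraMap_toAlgebra]
    exact LocallyOfFiniteType.stalkMap f x
  haveI : Algebra.FormallyUnramified (Y.presheaf.stalk (f.base x)) (X.presheaf.stalk x) := by
    rw [← RingHom.formallyUnramified_algebraMap, RingHom.algebraMap_toAlgebra]
    exact FormallyUnramified.stalkMap f x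
  exact Algebra.FormallyUnramified.map_maximalIdeal

/-- **A flat preimmersion induces isomorphisms on local rings** (surjective on stalks by definition; a flat local
homomorphism of local rings is faithfully flat, hence injective). [folklore] -/
theorem isIso_stalkMap_of_isPreimmersion_of_flat {X Y : Scheme.{u}} (g : X ⟶ Y) [IsPreimmersion g] [Flat g] (x : X) :
    IsIso (g.stalkMap x) := by
  have hsurj : Function.Surjective (g.stalkMap x) := g.stalkMap_surjective x
  have hinj : Function.Injective (g.stalkMap x) := by
    algebraize [(g.stalkMap x).hom]
    haveI : IsLocalHom (algebraMap (Y.presheaf.stalk (g.base x)) (X.presheaf.stalk x)) :=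
      inferInstanceAs <| IsLocalHom (g.stalkMap x).hom
    haveI : Module.Flat (Y.presheaf.stalk (g.base x)) (X.presheaf.stalk x) := Flat.stalkMap g x
    haveI : Module.FaithfullyFlat (Y.presheaf.stalk (g.base x)) (X.presheaf.stalk x) :=
      Module.FaithfullyFlat.of_flat_of_isLocalHom
    exact FaithfulSMul.algebraMap_injective (Y.presheaf.stalk (g.base x)) (X.presheaf.stalk x)
  exact (ConcreteCategory.isIso_iff_bijective (g.stalkMap x)).mpr ⟨hinj, hsurj⟩

/-- A bijective local homomorphism of local rings carries the maximal ideal ONTO the maximal ideal. [folklore] -/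
theorem map_maximalIdeal_eq_of_bijective {A B : Type*} [CommRing A] [CommRing B] [IsLocalRing A] [IsLocalRing B]
    (φ : A →+* B) [IsLocalHom φ] (hφ : Function.Bijective φ) : (maximalIdeal A).map φ = maximalIdeal B := by
  refine le_antisymm (((local_hom_TFAE φ).out 0 2 rfl rfl).mp ‹_›) fun b hb => ?_
  obtain ⟨a, rfl⟩ := hφ.2 b
  have ha : a ∈ maximalIdeal A := by
    rw [← IsLocalRing.maximalIdeal_comap φ]
    exact hb
  exact Ideal.mem_map_of_mem φ ha

/-- **Unramifiedness at a point is inherited through an isomorphism of local rings**: if `𝔪_{f₁ y}·𝒪_{Y,y} = 𝔪_y` at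
`y = g x` and `g` induces an isomorphism `𝒪_{Y,g x} ≅ 𝒪_{X,x}`, then `𝔪_{(g ≫ f₁) x}·𝒪_{X,x} = 𝔪_x`. [folklore] -/
theorem map_maximalIdeal_stalkMap_comp_eq {X Y Z : Scheme.{u}} (g : X ⟶ Y) (f₁ : Y ⟶ Z) (x : X)
    [IsIso (g.stalkMap x)]
    (h₁ : (maximalIdeal (Z.presheaf.stalk (f₁.base (g.base x)))).map (f₁.stalkMap (g.base x)).hom =
      maximalIdeal (Y.presheaf.stalk (g.base x))) :
    (maximalIdeal (Z.presheaf.stalk ((g ≫ f₁).base x))).map ((g ≫ f₁).stalkMap x).hom =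
      maximalIdeal (X.presheaf.stalk x) := by
  rw [Scheme.Hom.stalkMap_comp]
  change (maximalIdeal (Z.presheaf.stalk (f₁.base (g.base x)))).map
      ((g.stalkMap x).hom.comp (f₁.stalkMap (g.base x)).hom) = _
  rw [← Ideal.map_map, h₁]
  exact map_maximalIdeal_eq_of_bijective (g.stalkMap x).hom (ConcreteCategory.bijective_of_isIso (g.stalkMap x))

/-- **Corollary (the D2″ shape of (U))**: for `σ = σ₂ ≫ σ₁` with `σ₁` formally unramified and locally of finite type (e.g. a
base change of a finite étale morphism) and `σ₂` a flat preimmersion (e.g. a base change of a localisation), every point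
is unramified: `𝔪_{σ x}·𝒪_{X,x} = 𝔪_x`. [cite: StacksProject, Tag 00UW] -/
theorem map_maximalIdeal_stalkMap_eq_of_fac {X Y Z : Scheme.{u}} (σ₂ : X ⟶ Y) (σ₁ : Y ⟶ Z) [IsPreimmersion σ₂] [Flat σ₂]
    [FormallyUnramified σ₁] [LocallyOfFiniteType σ₁] {σ : X ⟶ Z} (hfac : σ₂ ≫ σ₁ = σ) (x : X) :
    (maximalIdeal (Z.presheaf.stalk (σ.base x))).map (σ.stalkMap x).hom = maximalIdeal (X.presheaf.stalk x) := by
  subst hfac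
  haveI := isIso_stalkMap_of_isPreimmersion_of_flat σ₂ x
  exact map_maximalIdeal_stalkMap_comp_eq σ₂ σ₁ x (map_maximalIdeal_stalkMap_eq_of_formallyUnramified σ₁ (σ₂.base x))

end Summit.ResolutionOfSingularities.ResolutionOfSingularities.Theorems.NoZeno.ExcCount

end
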